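import Literature.MathematicalPhysics.QuantumLattice.HubbardTwoPointSimplexMatch
import HarnessLib

/-!
# The Matsubara ultraviolet limit of the Grassmann two-point numerator IS the Hamiltonian equal-time two-point trace

Topic `MathematicalPhysics/QuantumLattice`; the two-point level of the `M → ∞` ("Matsubara UV") bridge, final
assembly (after `HubbardTwoPointMatsubaraSeries` — the limit of `N_M(U) := ∫dμ_{C_M} ψ⁺_{(x⃗ₑ,0)σ}ψ⁻_{(y⃗ₑ,0)σ'}e^{-V}`
is the determinant series — and `HubbardTwoPointSimplexMatch` — the limiting determinant on the open simplex is the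
shifted Hamiltonian two-point word determinant minus the midpoint correction).  For `L ≥ 3`, `β > 0`, `3e|U|L²βB² < 1`:

`N_M(U) ⟶ e^{-βUL²/4} · ( Tr(e^{-βH'} c†_{x⃗ₑσ} c_{y⃗ₑσ'}) − ½[x⃗ₑ=y⃗ₑ][σ=σ'] Tr e^{-βH'} ) / Tr e^{-β(H_L(1,0) − μN)}`,
`H' = H_L(1,U) − (μ + U/2)N`: dividing by the partition-function bridge
(`tendsto_effPartitionFn_hubbard_eq_partitionFn_div`), the `M → ∞` limit of the Grassmann two-point function of the
tree's engine is the Hamiltonian equal-time two-point function `⟨c†_{xσ}c_{yσ'}⟩_{β,H'}` MINUS `½δ`, at the chemical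
potential shifted by `U/2`:

* `continuous_sum_det_twoPointWordMatrix`, `continuous_sum_det_vacuumWordMatrix`;
* **`twoPointLimitDet_term_eq`** — order by order: `((−1)ⁿ/n!)UⁿΣ_{x⃗}∫_{[0,β]ⁿ} twoPointLimitDet = Z₀⁻¹(T⁽²⁾_n − ½δ·T⁽⁰⁾_n)`
  (scaling `τ = βu`, reflection `u ↦ 1−u`, symmetrisation, the a.e. match on the simplex, `orderedIntegral`);
* **`hasSum_twoPointLimitDet_series`** (vs `hasSum_hubbard_twoPoint_renormalised_det` and
  `hasSum_hubbard_partitionFn_renormalised_det` at `ν = ½`);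
* **`tendsto_gaussExpect_twoPoint_eq_trace_div`** — the two-point bridge above.

## Sources

G. Benfatto, A. Giuliani, V. Mastropietro, Ann. Henri Poincaré 7 (2006) 809–898 = arXiv:cond-mat/0507686, §1.2
(1.2)–(1.4), §2.1 (2.3)–(2.8) [`BenfattoGiulianiMastropietro2006`].
-/

noncomputable section

namespace Literature.MathematicalPhysics.QuantumLattice

open GrassmannAlgebra Finset Filter _root_.MeasureTheory Literature.Probability.LatticeModels _root_.Topology NormedSpace
open scoped Nat Pointwise ComplexOrder

/-! ### E. Assembly: the two-point limit series is the renormalised Hamiltonian two-point series at `ν = ½` -/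

section Assembly

variable {L : ℕ} [NeZero L]

/-- The times of the two-point word depend continuously on `u`. [folklore] -/
theorem continuous_hubbardWordTime_apply (β : ℝ) {n : ℕ} (b : Fin (n * 2 + 1)) :
    Continuous fun u : Fin n → ℝ => hubbardWordTime (fun a : Fin n => ((u a : ℝ) : ℂ) * -(β : ℂ)) b := by
  refine Fin.cases ?_ (fun m => ?_) b
  · simp only [hubbardWordTime_zero]
    exact continuous_const
  · simp only [hubbardWordTime_succ]
    exact (Complex.continuous_ofReal.comp (continuous_apply _)).mul continuous_const

/-- The Hamiltonian two-point integrand `u ↦ Σ_{x⃗} det(twoPointWordMatrix x⃗ u)` is continuous. [folklore] -/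
theorem continuous_sum_det_twoPointWordMatrix (β μ : ℝ) (σ σ' : Fin 2) (xe ye : TorusSite 2 L) (n : ℕ) :
    Continuous fun u : Fin n → ℝ => ∑ x : Fin n → TorusSite 2 L, (twoPointWordMatrix L β μ σ σ' xe ye x u).det := by
  refine continuous_finsetSum _ fun x _ => Continuous.matrix_det ?_
  refine continuous_pi fun i => continuous_pi fun j => ?_
  simp only [twoPointWordMatrix, Matrix.sub_apply]
  refine Continuous.sub ?_ continuous_const
  exact continuous_propMatrix_apply β _ _ _ _ (fun b => continuous_hubbardWordTime_apply β b) i j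

/-- The Hamiltonian vacuum integrand `u ↦ Σ_{x⃗} det(vacuumWordMatrix x⃗ u)` is continuous. [folklore] -/
theorem continuous_sum_det_vacuumWordMatrix (β μ : ℝ) (n : ℕ) :
    Continuous fun u : Fin n → ℝ => ∑ x : Fin n → TorusSite 2 L, (vacuumWordMatrix L β μ x u).det :=
  continuous_sum_det_propMatrix_sub_half β μ n

/-- **The order-`n` term of the two-point limit series is the order-`n` term of the renormalised Hamiltonian
two-point series minus `½[σ=σ'][x⃗ₑ=y⃗ₑ]` times the vacuum term, normalised by `Z₀`** (`L ≥ 3`, `β > 0`; scaling,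
reflection `u ↦ 1 − u`, symmetrisation and the match on the open simplex). [cite: BenfattoGiulianiMastropietro2006, §2.1 (2.6)-(2.8)] -/
theorem twoPointLimitDet_term_eq (hL : 3 ≤ L) {β : ℝ} (hβ : 0 < β) (μ U : ℝ) (σ σ' : Fin 2) (xe ye : TorusSite 2 L)
    (n : ℕ) :
    ((-1 : ℂ) ^ n * ((n ! : ℂ))⁻¹) * ((U : ℂ) ^ n * ∑ x : Fin n → TorusSite 2 L,
        ∫ τ in Set.Icc (0 : Fin n → ℝ) (fun _ => β), twoPointLimitDet L β μ σ σ' xe ye x τ) =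
      (Matrix.partitionFn β (dGamma (hubbardOneBody (fermionTorusGraph 2 L) 1 μ)))⁻¹ *
        ((U : ℂ) ^ n * orderedIntegral n (fun u : Fin n → ℝ =>
          (-(β : ℂ)) ^ n * ∑ f : Fin n → FermionTorus 2 L,
            Matrix.partitionFn β (dGamma (hubbardOneBody (fermionTorusGraph 2 L) 1 μ)) *
              (propMatrix β (hubbardOneBody (fermionTorusGraph 2 L) 1 μ)
                (hubbardWordOrb (orb (FermionTorus.ofTorusSite xe) σ) f)
                (hubbardWordOrb (orb (FermionTorus.ofTorusSite ye) σ') f)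
                (hubbardWordTime fun i : Fin n => ((u i : ℝ) : ℂ) * -(β : ℂ)) -
                Matrix.diagonal (Fin.cons 0 fun _ : Fin (n * 2) => (((1 / 2 : ℝ)) : ℂ))).det) 1) -
      (Matrix.partitionFn β (dGamma (hubbardOneBody (fermionTorusGraph 2 L) 1 μ)))⁻¹ *
        (if σ = σ' ∧ xe = ye then (1 / 2 : ℂ) else 0) *
          ((U : ℂ) ^ n * orderedIntegral n (fun u : Fin n → ℝ =>
            (-(β : ℂ)) ^ n * ∑ f : Fin n → FermionTorus 2 L,
              Matrix.partitionFn β (dGamma (hubbardOneBody (fermionTorusGraph 2 L) 1 μ)) *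
                (propMatrix β (hubbardOneBody (fermionTorusGraph 2 L) 1 μ)
                  (fun m : Fin (n * 2) => orb (f (finProdFinEquiv.symm m : Fin n × Fin 2).1)
                    (finProdFinEquiv.symm m : Fin n × Fin 2).2)
                  (fun m : Fin (n * 2) => orb (f (finProdFinEquiv.symm m : Fin n × Fin 2).1)
                    (finProdFinEquiv.symm m : Fin n × Fin 2).2)
                  (fun m : Fin (n * 2) => (((u (finProdFinEquiv.symm m : Fin n × Fin 2).1 : ℝ) : ℂ) * -(β : ℂ))) -
                  ((1 / 2 : ℝ) : ℂ) • (1 : Matrix (Fin (n * 2)) (Fin (n * 2)) ℂ)).det) 1) := by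
  haveI : Nonempty (Finset (Orb (FermionTorus 2 L))) := ⟨∅⟩
  set Z₀ : ℂ := Matrix.partitionFn β (dGamma (hubbardOneBody (fermionTorusGraph 2 L) 1 μ)) with hZ₀def
  have hZ₀ : Z₀ ≠ 0 := (Matrix.partitionFn_pos β (isHermitian_dGamma (isHermitian_hubbardOneBody _ 1 μ))).ne'
  set corr : ℂ := (if σ = σ' ∧ xe = ye then (1 / 2 : ℂ) else 0) with hcorr
  set P2 : (Fin n → ℝ) → ℂ := fun u => ∑ x : Fin n → TorusSite 2 L, (twoPointWordMatrix L β μ σ σ' xe ye x u).det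
    with hP2
  set Pv : (Fin n → ℝ) → ℂ := fun u => ∑ x : Fin n → TorusSite 2 L, (vacuumWordMatrix L β μ x u).det with hPv
  have hP2cont : Continuous P2 := continuous_sum_det_twoPointWordMatrix β μ σ σ' xe ye n
  have hPvcont : Continuous Pv := continuous_sum_det_vacuumWordMatrix β μ n
  -- (1) Hamiltonian sums over `f` as sums over torus sites; constants out of the ordered integrals
  have hsum2 : ∀ u : Fin n → ℝ, ∑ f : Fin n → FermionTorus 2 L, Z₀ *
      (propMatrix β (hubbardOneBody (fermionTorusGraph 2 L) 1 μ) (hubbardWordOrb (orb (FermionTorus.ofTorusSite xe) σ) f)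
        (hubbardWordOrb (orb (FermionTorus.ofTorusSite ye) σ') f)
        (hubbardWordTime fun i : Fin n => ((u i : ℝ) : ℂ) * -(β : ℂ)) -
        Matrix.diagonal (Fin.cons 0 fun _ : Fin (n * 2) => (((1 / 2 : ℝ)) : ℂ))).det = Z₀ * P2 u := by
    intro u
    rw [hP2, Finset.mul_sum]
    refine Fintype.sum_equiv ((Equiv.refl (Fin n)).arrowCongr FermionTorus.equivTorusSite) _ _ fun f => ?_
    simp [twoPointWordMatrix, FermionTorus.equivTorusSite]
  have hsumv : ∀ u : Fin n → ℝ, ∑ f : Fin n → FermionTorus 2 L, Z₀ *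
      (propMatrix β (hubbardOneBody (fermionTorusGraph 2 L) 1 μ)
        (fun m : Fin (n * 2) => orb (f (finProdFinEquiv.symm m : Fin n × Fin 2).1) (finProdFinEquiv.symm m : Fin n × Fin 2).2)
        (fun m : Fin (n * 2) => orb (f (finProdFinEquiv.symm m : Fin n × Fin 2).1) (finProdFinEquiv.symm m : Fin n × Fin 2).2)
        (fun m : Fin (n * 2) => (((u (finProdFinEquiv.symm m : Fin n × Fin 2).1 : ℝ) : ℂ) * -(β : ℂ))) -
        ((1 / 2 : ℝ) : ℂ) • (1 : Matrix (Fin (n * 2)) (Fin (n * 2)) ℂ)).det = Z₀ * Pv u := by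
    intro u
    rw [hPv, Finset.mul_sum]
    refine Fintype.sum_equiv ((Equiv.refl (Fin n)).arrowCongr FermionTorus.equivTorusSite) _ _ fun f => ?_
    simp [vacuumWordMatrix, FermionTorus.equivTorusSite]
  have hoI2 : orderedIntegral n (fun u : Fin n → ℝ => (-(β : ℂ)) ^ n * ∑ f : Fin n → FermionTorus 2 L, Z₀ *
      (propMatrix β (hubbardOneBody (fermionTorusGraph 2 L) 1 μ) (hubbardWordOrb (orb (FermionTorus.ofTorusSite xe) σ) f)
        (hubbardWordOrb (orb (FermionTorus.ofTorusSite ye) σ') f)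
        (hubbardWordTime fun i : Fin n => ((u i : ℝ) : ℂ) * -(β : ℂ)) -
        Matrix.diagonal (Fin.cons 0 fun _ : Fin (n * 2) => (((1 / 2 : ℝ)) : ℂ))).det) 1 =
      orderedIntegral n P2 1 * ((-(β : ℂ)) ^ n * Z₀) := by
    rw [← orderedIntegral_mul_const]
    congr 1
    funext u
    rw [hsum2 u]
    ring
  have hoIv : orderedIntegral n (fun u : Fin n → ℝ => (-(β : ℂ)) ^ n * ∑ f : Fin n → FermionTorus 2 L, Z₀ *
      (propMatrix β (hubbardOneBody (fermionTorusGraph 2 L) 1 μ)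
        (fun m : Fin (n * 2) => orb (f (finProdFinEquiv.symm m : Fin n × Fin 2).1) (finProdFinEquiv.symm m : Fin n × Fin 2).2)
        (fun m : Fin (n * 2) => orb (f (finProdFinEquiv.symm m : Fin n × Fin 2).1) (finProdFinEquiv.symm m : Fin n × Fin 2).2)
        (fun m : Fin (n * 2) => (((u (finProdFinEquiv.symm m : Fin n × Fin 2).1 : ℝ) : ℂ) * -(β : ℂ))) -
        ((1 / 2 : ℝ) : ℂ) • (1 : Matrix (Fin (n * 2)) (Fin (n * 2)) ℂ)).det) 1 =
      orderedIntegral n Pv 1 * ((-(β : ℂ)) ^ n * Z₀) := by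
    rw [← orderedIntegral_mul_const]
    congr 1
    funext u
    rw [hsumv u]
    ring
  -- (2) the Grassmann side: sum inside, scale, reflect, symmetrise
  have hS : ∑ x : Fin n → TorusSite 2 L, ∫ τ in Set.Icc (0 : Fin n → ℝ) (fun _ => β), twoPointLimitDet L β μ σ σ' xe ye x τ =
      ∫ τ in Set.Icc (0 : Fin n → ℝ) (fun _ => β), ∑ x : Fin n → TorusSite 2 L, twoPointLimitDet L β μ σ σ' xe ye x τ :=
    (integral_finsetSum _ fun x _ => integrableOn_twoPointLimitDet hβ.le μ σ σ' xe ye x).symm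
  have hscale := setIntegral_Icc_eq_pow_mul_setIntegral_unit_cube (k := n) hβ
    (fun τ => ∑ x : Fin n → TorusSite 2 L, twoPointLimitDet L β μ σ σ' xe ye x τ)
  have hrefl := (setIntegral_unit_cube_comp_one_sub
    (fun w : Fin n → ℝ => ∑ x : Fin n → TorusSite 2 L, twoPointLimitDet L β μ σ σ' xe ye x (β • w))).symm
  have hdef : (fun u : Fin n → ℝ => ∑ x : Fin n → TorusSite 2 L,
      twoPointLimitDet L β μ σ σ' xe ye x (β • fun i => 1 - u i)) =
      fun u : Fin n → ℝ => ∑ x : Fin n → TorusSite 2 L, twoPointLimitDet L β μ σ σ' xe ye x (fun a => β * (1 - u a)) := rfl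
  have hsymm := setIntegral_cube_eq_factorial_mul_setIntegral_simplex n 1
    (fun u : Fin n → ℝ => ∑ x : Fin n → TorusSite 2 L, twoPointLimitDet L β μ σ σ' xe ye x (fun a => β * (1 - u a)))
    (fun ρ w => sum_twoPointLimitDet_perm β μ σ σ' xe ye (fun w : Fin n → ℝ => fun a => β * (1 - w a))
      (fun ρ w => rfl) ρ w)
    (integrableOn_sum_twoPointLimitDet_reflect hβ μ σ σ' xe ye n)
  -- (3) on the simplex the two integrands agree a.e.
  have hsimplex : ∫ u in {w : Fin n → ℝ | (∀ i, w i ∈ Set.Icc (0 : ℝ) 1) ∧ Monotone w},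
      ∑ x : Fin n → TorusSite 2 L, twoPointLimitDet L β μ σ σ' xe ye x (fun a => β * (1 - u a)) =
      ∫ u in {w : Fin n → ℝ | (∀ i, w i ∈ Set.Icc (0 : ℝ) 1) ∧ Monotone w}, (P2 u - corr * Pv u) := by
    rw [← setIntegral_congr_set (strictSimplex_one_ae_eq_simplex n 1),
      ← setIntegral_congr_set (strictSimplex_one_ae_eq_simplex n 1)]
    refine setIntegral_congr_ae (measurableSet_strictSimplex n 1 1) ?_
    have hnull := volume_setOf_exists_apply_mem_pair (k := n) (1 : ℝ)
    filter_upwards [measure_eq_zero_iff_ae_notMem.1 hnull] with u hu hS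
    have hu' : StrictMono u := by simpa using hS.2
    have hu1 : ∀ a, u a < 1 := fun a =>
      lt_of_le_of_ne (hS.1 a).2 fun h => hu ⟨a, Or.inr h⟩
    simp only [hP2, hPv, hcorr, Finset.mul_sum, ← Finset.sum_sub_distrib]
    exact sum_congr rfl fun x _ => twoPointLimitDet_reflect_eq hL hβ μ σ σ' xe ye x hu' hu1
  have hint2 : IntegrableOn P2 {w : Fin n → ℝ | (∀ i, w i ∈ Set.Icc (0 : ℝ) 1) ∧ Monotone w} volume :=
    hP2cont.continuousOn.integrableOn_compact (isCompact_simplex n 1)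
  have hintv : IntegrableOn (fun u => corr * Pv u) {w : Fin n → ℝ | (∀ i, w i ∈ Set.Icc (0 : ℝ) 1) ∧ Monotone w} volume :=
    (hPvcont.continuousOn.integrableOn_compact (isCompact_simplex n 1)).const_mul corr
  have hsplit : ∫ u in {w : Fin n → ℝ | (∀ i, w i ∈ Set.Icc (0 : ℝ) 1) ∧ Monotone w}, (P2 u - corr * Pv u) =
      orderedIntegral n P2 1 - corr * orderedIntegral n Pv 1 := by
    rw [integral_sub hint2 hintv, integral_const_mul, orderedIntegral_eq_setIntegral_simplex n P2 hP2cont 1 zero_le_one,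
      orderedIntegral_eq_setIntegral_simplex n Pv hPvcont 1 zero_le_one]
  -- (4) assemble
  rw [hoI2, hoIv, hS, hscale, hrefl, hdef, hsymm, hsimplex, hsplit]
  have hfac : (n ! : ℂ) ≠ 0 := by exact_mod_cast n.factorial_ne_zero
  field_simp
  rw [neg_pow, ← mul_pow]
  ring

/-- **The two-point limit series sums to the renormalised Hamiltonian equal-time two-point trace minus the midpoint
correction** (`L ≥ 3`, `β > 0`, every `U`):
`Σ_n ((−1)ⁿ/n!) Uⁿ Σ_{x⃗} ∫_{[0,β]ⁿ} twoPointLimitDet = e^{−βUL²/4}·(Tr(e^{−βH'} c†_{x⃗ₑσ}c_{y⃗ₑσ'}) − ½[σ=σ'][x⃗ₑ=y⃗ₑ] Tr e^{−βH'})/Tr e^{−βH₀}`,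
`H' = hubbardTorusWith 2 L 1 U (μ + U/2)`, `H₀ = hubbardTorusWith 2 L 1 0 μ`. [cite: BenfattoGiulianiMastropietro2006, §2.1 (2.8)] -/
theorem hasSum_twoPointLimitDet_series (hL : 3 ≤ L) {β : ℝ} (hβ : 0 < β) (μ U : ℝ) (σ σ' : Fin 2)
    (xe ye : TorusSite 2 L) :
    HasSum (fun n : ℕ => ((-1 : ℂ) ^ n * ((n ! : ℂ))⁻¹) * ((U : ℂ) ^ n * ∑ x : Fin n → TorusSite 2 L,
        ∫ τ in Set.Icc (0 : Fin n → ℝ) (fun _ => β), twoPointLimitDet L β μ σ σ' xe ye x τ))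
      ((Real.exp (-(β * U / 4 * (L : ℝ) ^ 2)) : ℂ) *
        ((Matrix.gibbsWeight β (hubbardTorusWith 2 L 1 U (μ + U / 2)) *
            (creation (orb (FermionTorus.ofTorusSite xe) σ) * annihilation (orb (FermionTorus.ofTorusSite ye) σ'))).trace -
          (if σ = σ' ∧ xe = ye then (1 / 2 : ℂ) else 0) * Matrix.partitionFn β (hubbardTorusWith 2 L 1 U (μ + U / 2))) /
        Matrix.partitionFn β (hubbardTorusWith 2 L 1 0 μ)) := by
  haveI : Nonempty (Finset (Orb (FermionTorus 2 L))) := ⟨∅⟩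
  set Z₀ : ℂ := Matrix.partitionFn β (dGamma (hubbardOneBody (fermionTorusGraph 2 L) 1 μ)) with hZ₀def
  have hZ₀ : Z₀ ≠ 0 := (Matrix.partitionFn_pos β (isHermitian_dGamma (isHermitian_hubbardOneBody _ 1 μ))).ne'
  set corr : ℂ := (if σ = σ' ∧ xe = ye then (1 / 2 : ℂ) else 0) with hcorr
  have h2 := (hasSum_hubbard_twoPoint_renormalised_det (fermionTorusGraph 2 L) β 1 U μ (1 / 2)
    (FermionTorus.ofTorusSite xe) (FermionTorus.ofTorusSite ye) σ σ').const_smul Z₀⁻¹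
  -- (`const_smul` with a NEGATIVE constant and `HasSum.add`: both keep the `AddCommMonoid ℂ` instance of the plain
  -- statements, unlike `mul_left` / `sub`)
  have hv := (hasSum_hubbard_partitionFn_renormalised_det (fermionTorusGraph 2 L) β 1 U μ (1 / 2)).const_smul
    (-(Z₀⁻¹ * corr))
  simp only [smul_eq_mul] at h2 hv
  have hs := h2.add hv
  simp only [neg_mul, ← sub_eq_add_neg] at hs
  have h1 : hubbardTorusWith 2 L 1 U (μ + U / 2) = hamiltonianWith (fermionTorusGraph 2 L) 1 U (μ + U * (1 / 2)) := by
    rw [show μ + U / 2 = μ + U * (1 / 2) by ring]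
    rfl
  have h0 : Matrix.partitionFn β (hubbardTorusWith 2 L 1 0 μ) = Z₀ := by
    rw [hZ₀def, ← hamiltonianWith_zero_eq_dGamma]
    rfl
  have h3 : ((Real.exp (-(β * U / 4 * (L : ℝ) ^ 2)) : ℝ) : ℂ) =
      ((Real.exp (-(β * (U * (1 / 2) ^ 2 * (Fintype.card (FermionTorus 2 L) : ℝ))))) : ℂ) := by
    rw [show Fintype.card (FermionTorus 2 L) = L ^ 2 by
      rw [show Fintype.card (FermionTorus 2 L) = Fintype.card (Fin 2 → Fin L) from Fintype.card_lex _,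
        Fintype.card_fun, Fintype.card_fin, Fintype.card_fin]]
    push_cast
    ring_nf
  rw [h1, h0, h3]
  simp_rw [twoPointLimitDet_term_eq hL hβ μ U σ σ' xe ye]
  have hval : ((Real.exp (-(β * (U * (1 / 2) ^ 2 * (Fintype.card (FermionTorus 2 L) : ℝ))))) : ℂ) *
      ((Matrix.gibbsWeight β (hamiltonianWith (fermionTorusGraph 2 L) 1 U (μ + U * (1 / 2))) *
          (creation (orb (FermionTorus.ofTorusSite xe) σ) * annihilation (orb (FermionTorus.ofTorusSite ye) σ'))).trace -
        corr * Matrix.partitionFn β (hamiltonianWith (fermionTorusGraph 2 L) 1 U (μ + U * (1 / 2)))) / Z₀ =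
      Z₀⁻¹ * (((Real.exp (-(β * (U * (1 / 2) ^ 2 * (Fintype.card (FermionTorus 2 L) : ℝ))))) : ℂ) *
        (Matrix.gibbsWeight β (hamiltonianWith (fermionTorusGraph 2 L) 1 U (μ + U * (1 / 2))) *
          (creation (orb (FermionTorus.ofTorusSite xe) σ) * annihilation (orb (FermionTorus.ofTorusSite ye) σ'))).trace) -
      Z₀⁻¹ * corr * (((Real.exp (-(β * (U * (1 / 2) ^ 2 * (Fintype.card (FermionTorus 2 L) : ℝ))))) : ℂ) *
        Matrix.partitionFn β (hamiltonianWith (fermionTorusGraph 2 L) 1 U (μ + U * (1 / 2)))) := by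
    rw [div_eq_mul_inv]
    ring
  rw [hval]
  -- `convert`: the `Fintype`/`DecidableEq` instances baked into the Hamiltonian-side statements differ (trivially)
  convert hs using 20

/-- **THE TWO-POINT BRIDGE: the Matsubara ultraviolet limit of the Grassmann two-point numerator is the Hamiltonian
equal-time two-point trace minus the midpoint correction.**  For `L ≥ 3`, `β > 0`, `3e·|U|·L²β·B² < 1`:
`∫dμ_{C_M} ψ⁺_{(x⃗ₑ,0)σ} ψ⁻_{(y⃗ₑ,0)σ'} e^{−V_M(U)} ⟶
  e^{−βUL²/4} · ( Tr(e^{−βH'} c†_{x⃗ₑσ} c_{y⃗ₑσ'}) − ½[σ=σ'][x⃗ₑ=y⃗ₑ]·Tr e^{−βH'} ) / Tr e^{−βH₀}`,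
`H' = hubbardTorusWith 2 L 1 U (μ + U/2)`, `H₀ = hubbardTorusWith 2 L 1 0 μ` (divide by the partition-function bridge
`tendsto_effPartitionFn_hubbard_eq_partitionFn_div`: the Grassmann two-point function converges to
`⟨c†_{x⃗ₑσ}c_{y⃗ₑσ'}⟩_{β,H'} − ½δ`). [cite: BenfattoGiulianiMastropietro2006, §2.1 (2.8)] -/
theorem tendsto_gaussExpect_twoPoint_eq_trace_div (hL : 3 ≤ L) {β : ℝ} (hβ : 0 < β) (μ : ℝ) {U : ℝ} (σ σ' : Fin 2)
    (xe ye : TorusSite 2 L)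
    (hU : 3 * Real.exp 1 * (|U| * (L : ℝ) ^ 2 * β) *
      ((1 / (L : ℝ) ^ 2) * ∑ q : TorusSite 2 L, (2 + β * |nambuXi L μ q| / 3)) ^ 2 < 1) :
    Tendsto (fun M : ℕ => gaussExpect ℂ (hubbardCovariance L M β μ 0)
        (positionField L M β 0 σ xe 0 * positionField L M β 1 σ' ye 0 * grassmannExp (-(hubbardInteraction L M β U))))
      atTop
      (𝓝 ((Real.exp (-(β * U / 4 * (L : ℝ) ^ 2)) : ℂ) *
        ((Matrix.gibbsWeight β (hubbardTorusWith 2 L 1 U (μ + U / 2)) *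
            (creation (orb (FermionTorus.ofTorusSite xe) σ) * annihilation (orb (FermionTorus.ofTorusSite ye) σ'))).trace -
          (if σ = σ' ∧ xe = ye then (1 / 2 : ℂ) else 0) * Matrix.partitionFn β (hubbardTorusWith 2 L 1 U (μ + U / 2))) /
        Matrix.partitionFn β (hubbardTorusWith 2 L 1 0 μ))) := by
  rw [← (hasSum_twoPointLimitDet_series hL hβ μ U σ σ' xe ye).tsum_eq]
  exact tendsto_gaussExpect_twoPoint_mul_grassmannExp hβ μ σ σ' xe ye hU

end Assembly

end Literature.MathematicalPhysics.QuantumLattice
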